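import Summits.Parity.BatemanHorn.Theses.RoughParitySectors
import Summits.Parity.BatemanHorn.Theorems.RoughParitySectorsOddSectorShareLinearIntegerShare

/-!
# Route `RoughParitySectors`: the support item `LinearCalibration` (stmt-Parity-15631), PROVED —
# the integer case of both cruxes (parity balance and odd-sector share of the rough INTEGERS)

By the lead of crux `OddSectorShareNonlinear` (stmt-Parity-15628), as a by-product of that line:
the integer case `f = (X)` of the route's two crux shapes, written over `ℕ` exactly as the item
states it.  With `R(x,U) = {1 ≤ n ≤ x : no prime p < ⌈x^{1/U}⌉₊ divides n}`, `P` its prime cell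
(`Ω = 1`), `O` its odd cell (`Ω` odd) and `Φ = #R`:

* (i)  `|2·O − Φ| ≤ δ·Φ` for `U ≥ U₀(δ)`, eventually in `x` (parity balance of the rough integers);
* (ii) `|P·(U e^{−γ}/2) − O| ≤ η·O` for `U ≥ U₀(η)`, eventually in `x` (the prime share of the
  odd sector is the Buchstab share).

Everything is PROVED from the tree.  (ii) is ALREADY LANDED verbatim by the sibling line of crux
`OddSectorShareLinear` as `OddSectorShareLinear.Birth.stub_integerShare`
(`RoughParitySectorsOddSectorShareLinearIntegerShare.lean`; it rests on the integer cell law and on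
this line's landed stub `OddSectorShareNonlinear.Birth.stub_oddBuchstabMass`) and is reused, not
restated.  (i) is proved here: the integer cells are the `α = 1, β = 0` case of the linear cell law
(`OneFormShare.tendsto_card_filter_odd`, `OmegaClassShapeSplit.LinearCells.tendsto_card_filter_linear_cell`,
i.e. Alladi's theorem), so for fixed `U > 2`: `O·log x/x → T(U) = Σ_{j odd ≤ ⌊U⌋} I_j(U)` and
`Φ·log x/x → Σ_{j ≤ ⌊U⌋} I_j(U) = U ω(U)` (`oddMass_sum_range_floor_eq`); then (i) is Alladi's
parity balance in limit form `|Σ_j (−1)^j I_j(U)| ≤ 1` (`oddMass_abs_alternating_le_one`) against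
`U ω(U) → ∞` (`ω → e^{−γ} > 1/2`, `harman2007_buchstabOmega_tendsto_holds`).

Main declarations (namespace `Summit.Parity.BatemanHorn.Theorems.LinearCalibration`):
`sum_range_eq_sum_range_floor` (cells `j > U` carry no mass), `totalMass_eq_sum_succ`,
`tendsto_odd`, `tendsto_total`, `parityBalance`, and
`linearCalibration_proof : Theses.RoughParitySectors.LinearCalibration := ⟨parityBalance, stub_integerShare⟩`.

References: K. Alladi, Quart. J. Math. Oxford (2) 33 (1982) 129–148, Thm 1 [Alladi1982];
Montgomery–Vaughan, *Multiplicative Number Theory I*, §7.2 [MontgomeryVaughan2007];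
G. Tenenbaum, *Introduction to analytic and probabilistic number theory*, III.6 [Tenenbaum2015].
-/

noncomputable section

open Filter Finset
open scoped Topology ArithmeticFunction.Omega
open Literature.NumberTheory.Sieve
open Summit.Parity.BatemanHorn.Cruxes.OddSectorShareLinear.Birth
open Summit.Parity.BatemanHorn.Cruxes.OddSectorShareLinear.Birth.OneFormShare
open Summit.Parity.BatemanHorn.Cruxes.OddSectorShareNonlinear.Birth
open Summit.Parity.BatemanHorn.Cruxes.RoughValueLaw.OmegaClassShapeSplit

namespace Summit.Parity.BatemanHorn.Theorems.LinearCalibration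

/-! ### §1 Model side: cells beyond the depth carry no mass -/

/-- If `F j = 0` whenever `U < j`, then `Σ_{j < K} F j = Σ_{j ≤ ⌊U⌋} F j` for every `K > ⌊U⌋`.
[folklore] -/
theorem sum_range_eq_sum_range_floor (F : ℕ → ℝ) {U : ℝ} (hU : 0 ≤ U)
    (hF : ∀ j : ℕ, U < j → F j = 0) {K : ℕ} (hK : ⌊U⌋₊ + 1 ≤ K) :
    ∑ j ∈ range K, F j = ∑ j ∈ range (⌊U⌋₊ + 1), F j := by
  refine (sum_subset (range_subset_range.2 hK) fun j _ hj => hF j ?_).symm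
  rw [mem_range, not_lt] at hj
  exact (Nat.floor_lt hU).1 (by omega)

/-- The total Buchstab mass: `Σ_{i ≤ ⌈U⌉} I_{i+1}(U) = U ω(U)` for `U ≥ 1`
(`oddMass_sum_range_floor_eq`; `I_0 = 0`, `I_j(U) = 0` for `j > U`). [folklore] -/
theorem totalMass_eq_sum_succ {U : ℝ} (hU : 1 ≤ U) :
    ∑ i ∈ range (⌈U⌉₊ + 1), roughCellDensity (i + 1) U = U * buchstabOmega U := by
  have hU0 : 0 ≤ U := by linarith
  have h1 : ∑ i ∈ range (⌈U⌉₊ + 1), roughCellDensity (i + 1) U =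
      ∑ j ∈ range (⌈U⌉₊ + 1 + 1), roughCellDensity j U := by
    rw [sum_range_succ' (fun j => roughCellDensity j U), roughCellDensity_zero, add_zero]
  rw [h1, sum_range_eq_sum_range_floor (fun j => roughCellDensity j U) hU0
    (fun j hj => roughCellDensity_of_lt j hj) (by have := Nat.floor_le_ceil U; omega),
    oddMass_sum_range_floor_eq hU]

/-- `1/2 < e^{−γ}` (from `γ < 2/3 < log 2`). [folklore] -/
theorem half_lt_exp_neg_eulerMascheroni : (1 : ℝ) / 2 < Real.exp (-Real.eulerMascheroniConstant) := by
  have h1 : Real.eulerMascheroniConstant < 2 / 3 := Real.eulerMascheroniConstant_lt_two_thirds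
  have h2 : (2 : ℝ) / 3 < Real.log 2 := by have := Real.log_two_gt_d9; linarith
  have h3 : Real.exp (-(Real.log 2)) < Real.exp (-Real.eulerMascheroniConstant) :=
    Real.exp_lt_exp.2 (by linarith)
  rwa [Real.exp_neg, Real.exp_log two_pos, inv_eq_one_div] at h3

/-! ### §2 Integer side: the three cell asymptotics at fixed depth `U > 2` -/

/-- The integers' rough set lies in the `α = 1, β = 0` linear-form rough set (same elements).
[folklore] -/
theorem mem_linear_of_mem {x T n : ℕ}
    (hn : n ∈ (Icc 1 x).filter (fun n : ℕ => ∀ p ∈ range T, p.Prime → ¬ (p ∣ n))) :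
    n ∈ (Icc 1 x).filter (fun n : ℕ => 0 < (1 : ℤ) * n + 0 ∧
      ∀ p ∈ range T, p.Prime → ¬ ((p : ℤ) ∣ (1 : ℤ) * n + 0)) := by
  rw [mem_filter] at hn ⊢
  have hn0 : (0 : ℤ) < n := by have := (mem_Icc.mp hn.1).1; omega
  simp only [one_mul, add_zero, Int.natCast_dvd_natCast]
  exact ⟨hn.1, hn0, hn.2⟩

/-- `(0 mod 1)` is prime to `1`. [folklore] -/
theorem coprime_zero_one : (((0 : ℤ) % 1).toNat).Coprime (1 : ℤ).toNat := by decide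

/-- **Odd cell of the rough integers**: `O(x,U)·log x/x → T(U) = Σ_{j ≤ ⌊U⌋, j odd} I_j(U)`
(`U > 2`). [folklore] -/
theorem tendsto_odd {U : ℝ} (hU : 2 < U) :
    Tendsto (fun x : ℕ => (#(((Icc 1 x).filter (fun n : ℕ =>
        ∀ p ∈ range ⌈(x : ℝ) ^ (1 / U)⌉₊, p.Prime → ¬ (p ∣ n))).filter
          (fun n : ℕ => Odd (Ω n))) : ℝ) * Real.log x / x) atTop
      (𝓝 (∑ j ∈ (range (⌊U⌋₊ + 1)).filter Odd, roughCellDensity j U)) := by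
  have h := tendsto_card_filter_odd (β := 0) one_pos coprime_zero_one hU
  have h1 : ((1 : ℤ) : ℝ) / ((((1 : ℤ).toNat).totient : ℕ) : ℝ) = 1 := by norm_num
  rw [h1, one_mul, IntegerShare.sum_filter_even_succ_eq_oddMass U] at h
  refine h.congr fun x => ?_
  rw [← filter_filter_eq_linear_odd x _]

/-- **Total count of the rough integers**: `Φ(x,U)·log x/x → U ω(U)` (`U > 2`): eventually
`Ω ≤ ⌈U⌉ + 1` on the rough set, so `Φ = #{Ω = 0} + Σ_{i ≤ ⌈U⌉} #{Ω = i+1}` with `#{Ω = 0} ≤ 1`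
(only `n = 1`), and the cells have limits `I_{i+1}(U)` summing to `U ω(U)`. [folklore] -/
theorem tendsto_total {U : ℝ} (hU : 2 < U) :
    Tendsto (fun x : ℕ => (#((Icc 1 x).filter (fun n : ℕ =>
        ∀ p ∈ range ⌈(x : ℝ) ^ (1 / U)⌉₊, p.Prime → ¬ (p ∣ n))) : ℝ) * Real.log x / x) atTop
      (𝓝 (U * buchstabOmega U)) := by
  -- the cells `Ω = i + 1`, `i ≤ ⌈U⌉`
  have hcells : ∀ i : ℕ, Tendsto (fun x : ℕ => (#(((Icc 1 x).filter (fun n : ℕ =>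
      ∀ p ∈ range ⌈(x : ℝ) ^ (1 / U)⌉₊, p.Prime → ¬ (p ∣ n))).filter
        (fun n : ℕ => Ω n = i + 1)) : ℝ) * Real.log x / x) atTop
        (𝓝 (roughCellDensity (i + 1) U)) := by
    intro i
    have h := LinearCells.tendsto_card_filter_linear_cell (β := 0) one_pos coprime_zero_one i hU
    have h1 : ((1 : ℤ) : ℝ) / ((((1 : ℤ).toNat).totient : ℕ) : ℝ) = 1 := by norm_num
    rw [h1, one_mul] at h
    refine h.congr fun x => ?_
    rw [← filter_filter_eq_linear_eq x _ (i + 1)]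
  have hsum := tendsto_finsetSum (range (⌈U⌉₊ + 1)) fun i _ => hcells i
  rw [totalMass_eq_sum_succ (by linarith)] at hsum
  -- the cell `Ω = 0` has at most one element and `log x/x → 0`
  have hzero : Tendsto (fun x : ℕ => (#(((Icc 1 x).filter (fun n : ℕ =>
      ∀ p ∈ range ⌈(x : ℝ) ^ (1 / U)⌉₊, p.Prime → ¬ (p ∣ n))).filter
        (fun n : ℕ => Ω n = 0)) : ℝ) * Real.log x / x) atTop (𝓝 0) := by
    have hlog : Tendsto (fun x : ℕ => Real.log x / x) atTop (𝓝 0) := by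
      have h := Real.tendsto_pow_log_div_mul_add_atTop 1 0 1 one_ne_zero
      simp only [pow_one, one_mul, add_zero] at h
      exact h.comp tendsto_natCast_atTop_atTop
    refine squeeze_zero' ?_ ?_ hlog
    · filter_upwards [eventually_ge_atTop 1] with x hx
      have : 0 ≤ Real.log x := Real.log_nonneg (by exact_mod_cast hx)
      positivity
    · filter_upwards [eventually_ge_atTop 1] with x hx
      have hlog : 0 ≤ Real.log x := Real.log_nonneg (by exact_mod_cast hx)
      have hcard : #(((Icc 1 x).filter (fun n : ℕ =>
          ∀ p ∈ range ⌈(x : ℝ) ^ (1 / U)⌉₊, p.Prime → ¬ (p ∣ n))).filter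
            (fun n : ℕ => Ω n = 0)) ≤ 1 := by
        rw [← card_singleton 1]
        refine card_le_card fun n hn => ?_
        rw [mem_filter, mem_filter, mem_Icc] at hn
        rw [mem_singleton]
        have h0 := hn.2
        have hn1 : 1 ≤ n := hn.1.1.1
        rw [ArithmeticFunction.cardFactors_apply, List.length_eq_zero_iff,
          Nat.primeFactorsList_eq_nil] at h0
        omega
      have hc : (#(((Icc 1 x).filter (fun n : ℕ =>
          ∀ p ∈ range ⌈(x : ℝ) ^ (1 / U)⌉₊, p.Prime → ¬ (p ∣ n))).filter
            (fun n : ℕ => Ω n = 0)) : ℝ) ≤ 1 := by exact_mod_cast hcard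
      have hx0 : (0 : ℝ) < x := by exact_mod_cast hx
      rw [mul_div_assoc]
      calc _ ≤ 1 * (Real.log x / x) :=
            mul_le_mul_of_nonneg_right hc (div_nonneg hlog hx0.le)
        _ = Real.log x / x := one_mul _
  have hall := hzero.add hsum
  rw [zero_add] at hall
  refine hall.congr' ?_
  -- eventually `Ω ≤ ⌈U⌉ + 1` on the rough set, so the fibres over `range (⌈U⌉ + 2)` exhaust it
  filter_upwards [eventually_cardFactors_le (β := 0) one_pos hU] with x hx
  set R : Finset ℕ := (Icc 1 x).filter (fun n : ℕ =>
    ∀ p ∈ range ⌈(x : ℝ) ^ (1 / U)⌉₊, p.Prime → ¬ (p ∣ n)) with hR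
  have H : ∀ n ∈ R, Ω n ∈ range (⌈U⌉₊ + 1 + 1) := by
    intro n hn
    have h := hx n (mem_linear_of_mem hn)
    simp only [one_mul, add_zero, Int.toNat_natCast] at h
    exact mem_range.2 (by omega)
  rw [card_eq_sum_card_fiberwise H, sum_range_succ' (fun m => #(R.filter (fun n => Ω n = m))),
    Nat.cast_add, Nat.cast_sum, add_mul, add_div, sum_mul, sum_div, add_comm]

/-! ### §3 The two statements -/

/-- **(i) Parity balance of the rough integers**: for every `δ > 0` there is `U₀` such that for
every `U ≥ U₀`, eventually in `x`, `|2·O(x,U) − Φ(x,U)| ≤ δ·Φ(x,U)`.  At fixed `U`: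
`(2O − Φ)·log x/x → 2T(U) − Uω(U) = −Σ_{j ≤ ⌊U⌋} (−1)^j I_j(U)`, of absolute value `≤ 1`
(`oddMass_abs_alternating_le_one`), while `Φ·log x/x → Uω(U) ≥ U/2 ≥ 4/δ` for
`U ≥ max(8/δ, U₁)` (`ω(U) > 1/2` for `U ≥ U₁` as `ω → e^{−γ} > 1/2`). [folklore] -/
theorem parityBalance :
    ∀ δ : ℝ, 0 < δ → ∃ U₀ : ℝ, ∀ U : ℝ, U₀ ≤ U → ∀ᶠ x : ℕ in Filter.atTop,
      |2 * (((((Finset.Icc 1 x).filter (fun n : ℕ => ∀ p ∈ Finset.range ⌈(x : ℝ) ^ (1 / U)⌉₊,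
          p.Prime → ¬ (p ∣ n))).filter (fun n : ℕ => Odd (ArithmeticFunction.cardFactors n))).card
            : ℕ) : ℝ) -
        ((((Finset.Icc 1 x).filter (fun n : ℕ => ∀ p ∈ Finset.range ⌈(x : ℝ) ^ (1 / U)⌉₊,
          p.Prime → ¬ (p ∣ n))).card : ℕ) : ℝ)| ≤
        δ * ((((Finset.Icc 1 x).filter (fun n : ℕ => ∀ p ∈ Finset.range ⌈(x : ℝ) ^ (1 / U)⌉₊,
          p.Prime → ¬ (p ∣ n))).card : ℕ) : ℝ) := by
  intro δ₀ hδ₀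
  -- work with `δ = min δ₀ 1`
  set δ : ℝ := min δ₀ 1 with hδdef
  have hδ : 0 < δ := lt_min hδ₀ one_pos
  have hδ1 : δ ≤ 1 := min_le_right _ _
  have hδδ₀ : δ ≤ δ₀ := min_le_left _ _
  -- `ω(U) > 1/2` for large `U`
  have hω : ∀ᶠ U : ℝ in atTop, 1 / 2 < buchstabOmega U := by
    have h := harman2007_buchstabOmega_tendsto_holds
    unfold harman2007_buchstabOmega_tendsto at h
    exact h.eventually (lt_mem_nhds half_lt_exp_neg_eulerMascheroni)
  obtain ⟨U₁, hU₁⟩ := (hω.and (eventually_ge_atTop (max 3 (8 / δ)))).exists_forall_of_atTop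
  refine ⟨U₁, fun U hU => ?_⟩
  obtain ⟨hωU, hU3⟩ := hU₁ U hU
  have hU3' : (3 : ℝ) ≤ U := le_trans (le_max_left _ _) hU3
  have hUδ : 8 / δ ≤ U := le_trans (le_max_right _ _) hU3
  have hU2 : (2 : ℝ) < U := by linarith
  -- the model quantities at this depth
  set T : ℝ := ∑ j ∈ (range (⌊U⌋₊ + 1)).filter Odd, roughCellDensity j U with hT
  set W : ℝ := U * buchstabOmega U with hW
  set Alt : ℝ := ∑ j ∈ range (⌊U⌋₊ + 1), (-1 : ℝ) ^ j * roughCellDensity j U with hAlt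
  have hTW : 2 * T - W = -Alt := by
    rw [hT, oddMass_sum_filter_odd_eq, oddMass_sum_range_floor_eq (by linarith), hW, hAlt]; ring
  have hAlt1 : |Alt| ≤ 1 := oddMass_abs_alternating_le_one hU2.le
  have hW0 : 4 / δ ≤ W := by
    rw [hW]
    have : U / 2 ≤ U * buchstabOmega U := by nlinarith
    calc 4 / δ = (8 / δ) / 2 := by ring
      _ ≤ U / 2 := by linarith
      _ ≤ _ := this
  have hWpos : 0 < W := lt_of_lt_of_le (by positivity) hW0
  have hδW : 1 ≤ δ / 4 * W := by
    have := mul_le_mul_of_nonneg_left hW0 (by positivity : (0 : ℝ) ≤ δ / 4)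
    rwa [show δ / 4 * (4 / δ) = 1 by field_simp] at this
  -- the limits in `x`, with tolerance `(δ/16)·W`
  have ho := tendsto_odd hU2
  have ht := tendsto_total hU2
  have hε : 0 < δ / 16 * W := by positivity
  filter_upwards [Metric.tendsto_nhds.1 ho _ hε, Metric.tendsto_nhds.1 ht _ hε,
    eventually_gt_atTop 1] with x hox htx hx1
  rw [Real.dist_eq] at hox htx
  set L : ℝ := Real.log x / x with hL
  have hX : (0 : ℝ) < x := by exact_mod_cast (zero_lt_one.trans hx1)
  have hL0 : 0 < L := div_pos (Real.log_pos (by exact_mod_cast hx1)) hX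
  set O : ℝ := (#(((Icc 1 x).filter (fun n : ℕ => ∀ p ∈ range ⌈(x : ℝ) ^ (1 / U)⌉₊,
    p.Prime → ¬ (p ∣ n))).filter (fun n : ℕ => Odd (Ω n))) : ℝ) with hO
  set Φ : ℝ := (#((Icc 1 x).filter (fun n : ℕ => ∀ p ∈ range ⌈(x : ℝ) ^ (1 / U)⌉₊,
    p.Prime → ¬ (p ∣ n))) : ℝ) with hΦ
  have hoL : O * Real.log x / x = O * L := by rw [hL, mul_div_assoc]
  have htL : Φ * Real.log x / x = Φ * L := by rw [hL, mul_div_assoc]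
  rw [hoL] at hox
  rw [htL] at htx
  -- `|(2O − Φ)L| ≤ 2|OL − T| + |2T − W| + |W − ΦL| ≤ δ/8 W + 1 + δ/16 W ≤ (7/16)δW ≤ δ ΦL`
  obtain ⟨ho1, ho2⟩ := abs_lt.1 hox
  obtain ⟨ht1, ht2⟩ := abs_lt.1 htx
  obtain ⟨ha1, ha2⟩ := abs_le.1 hAlt1
  have hδW16 : δ / 16 * W ≤ 1 / 16 * W := mul_le_mul_of_nonneg_right (by linarith) hWpos.le
  have hΦL : 15 / 16 * W ≤ Φ * L := by linarith
  have h5 : δ * (15 / 16 * W) ≤ δ * (Φ * L) := mul_le_mul_of_nonneg_left hΦL hδ.le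
  have hup : (2 * O - Φ) * L ≤ δ * Φ * L := by linarith
  have hdn : -(δ * Φ * L) ≤ (2 * O - Φ) * L := by linarith
  have key : |2 * O - Φ| * L ≤ δ * Φ * L := by
    rw [← abs_of_pos hL0, ← abs_mul, abs_of_pos hL0]
    exact abs_le.2 ⟨hdn, hup⟩
  have hfin : |2 * O - Φ| ≤ δ * Φ := le_of_mul_le_mul_right (by linarith [key]) hL0
  have hΦ0 : 0 ≤ Φ := by rw [hΦ]; exact Nat.cast_nonneg _
  exact hfin.trans (mul_le_mul_of_nonneg_right hδδ₀ hΦ0)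

/-- **The support item `LinearCalibration` (stmt-Parity-15631) BY NAME**: conjunct (i) is
`parityBalance`, conjunct (ii) is the sibling line's landed `stub_integerShare`. [folklore] -/
theorem linearCalibration_proof :
    Summit.Parity.BatemanHorn.Theses.RoughParitySectors.LinearCalibration :=
  ⟨parityBalance, stub_integerShare⟩

end Summit.Parity.BatemanHorn.Theorems.LinearCalibration

end
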